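import Summits.ResolutionOfSingularities.ResolutionOfSingularities.Theorems.ValuativeLuAlphaPTorsorContentMapLe
import Summits.ResolutionOfSingularities.ResolutionOfSingularities.Theorems.ValuativeLuAlphaPTorsorContentRich
import Summits.ResolutionOfSingularities.ResolutionOfSingularities.Theorems.ValuativeLuAlphaPTorsorQuadraticDerivation

/-!
# At the origin chart of a quadratic transform the log-content is the total transform

Helper file for the stub `content_quadraticTransform_origin` (T5, Giraud 1983 Rem. 1.6(4) in
tree language) of the line `pfaff-line-log-final-forms` (crux `Valuative.LuAlphaPTorsor`, item
`stmt-ResolutionOfSingularities-0641`).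

Setting: `K` a field, `O ⊆ K` a valuation ring, `R ⊆ R₁ ⊆ K` with `R` local and `R₁` the
quadratic transform of `R` along `O` (`IsQuadraticTransformAlong O R R₁`), `φ : R → R₁` the
inclusion. Let `u : Fin d → R` generate `𝔪_R`, with dual `ℤ`-derivations `D_i (u_j) = δ_ij`, let
`x := u i₀ ≠ 0`, and let `u' : Fin d → R₁` be the ORIGIN CHART coordinates: `u' i₀ = x`,
`u' j = u_j / x` (`j ≠ i₀`). With FULL boundary on both sides (every index logarithmic), the
LOG-CONTENT IDEAL `C(a) := Ideal.span {δ a | δ ∈ Der_ℤ, δ (u_i) ∈ (u_i) ∀ i}` satisfies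

  `C(φ f; R₁, u') = C(f; R, u) · R₁`       (`content_quadraticTransform_origin`).

* `≥` (`content_map_le_quadraticTransform_origin`): a logarithmic `δ ∈ Der_ℤ(R)` maps `𝔪_R`
  into itself, hence extends to `δ₁ ∈ Der_ℤ(R₁)` (`exists_derivation_quadraticTransformAlong`);
  `δ₁` is logarithmic along `u'`: `δ₁ x = φ (δ x) ∈ (x)` and, from `u'_j · x = φ (u_j)` and the
  Leibniz rule, `x · (δ₁ u'_j - (a - b) u'_j) = 0` where `δ u_j = a u_j`, `δ x = b x`; cancel `x`
  in the domain `R₁`. Conclude by `content_map_le_of_forall_exists_extension`.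
* `≤` (`content_quadraticTransform_origin_le_map`): by `content_le_map_of_rich` (richness of
  `R` and the dual derivations) it suffices that the old parameters `φ (u_i)` stay logarithmic
  for the `u'`-logarithmic derivations `δ'` of `R₁`: `φ (u_{i₀}) = u'_{i₀}`, and for `j ≠ i₀`,
  `δ' (u'_j x) = u'_j δ' x + x δ' u'_j ∈ (u'_j x)` (Giraud 1983, Rem. 1.6(4)). [folklore]
-/

set_option linter.dupNamespace false

namespace Summit.ResolutionOfSingularities.ResolutionOfSingularities.Theorems.PfaffLine

open IsLocalRing Literature.AlgebraicGeometry.Resolution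

section Origin

/-- A `ℤ`-derivation which is logarithmic along a family of generators `u` of an ideal `I`
(`δ (u i) ∈ (u i)` for all `i`) maps `I` into itself (Leibniz rule). [folklore] -/
theorem derivation_apply_mem_of_span_range_eq {A : Type*} [CommRing A] {d : ℕ} (u : Fin d → A)
    {I : Ideal A} (hspan : Ideal.span (Set.range u) = I) (δ : Derivation ℤ A A)
    (hδ : ∀ i, δ (u i) ∈ Ideal.span {u i}) : ∀ x ∈ I, δ x ∈ I := by
  intro x hx
  rw [← hspan] at hx ⊢
  refine Submodule.span_induction (p := fun y _ => δ y ∈ Ideal.span (Set.range u)) ?_ ?_ ?_ ?_ hx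
  · rintro _ ⟨i, rfl⟩
    exact Ideal.span_mono (Set.singleton_subset_iff.mpr (Set.mem_range_self i)) (hδ i)
  · rw [map_zero]
    exact zero_mem _
  · intro a b _ _ ha hb
    rw [map_add]
    exact add_mem ha hb
  · intro a b hb hb'
    rw [smul_eq_mul, Derivation.leibniz, smul_eq_mul, smul_eq_mul]
    exact add_mem (Ideal.mul_mem_left _ _ hb') (Ideal.mul_mem_right _ _ hb)

variable {K : Type} [Field K]

/-- **`C(f; R) · R₁ ≤ C(φ f; R₁)` at the origin chart** (Giraud 1983 Rem. 1.6(4), inclusion `≥`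
of `content_quadraticTransform_origin`). Every `u`-logarithmic `ℤ`-derivation `δ` of the local
ring `R` preserves `𝔪_R = (u_1, …, u_d)`, hence extends to a derivation `δ₁` of the quadratic
transform `R₁` (`exists_derivation_quadraticTransformAlong`), and `δ₁` is logarithmic along the
origin-chart coordinates `u' i₀ = x`, `u' j = u_j / x`: `δ₁ x = φ (δ x) ∈ (x)`, and
`x δ₁ (u'_j) = φ (δ u_j) - u'_j δ₁ x ∈ x · (u'_j)`, cancelling `x ≠ 0` in the domain `R₁`.
[folklore] -/
theorem content_map_le_quadraticTransform_origin (O : ValuationSubring K) (R R₁ : Subring K)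
    [IsLocalRing R] (h : IsQuadraticTransformAlong O R R₁) {d : ℕ} (u : Fin d → R)
    (hspan : Ideal.span (Set.range u) = maximalIdeal R) (i₀ : Fin d) (hx : (u i₀ : K) ≠ 0)
    (u' : Fin d → R₁) (hi₀ : (u' i₀ : K) = (u i₀ : K))
    (hj : ∀ j, j ≠ i₀ → (u' j : K) = (u j : K) / (u i₀ : K)) (f : R) :
    (Ideal.span {b | ∃ δ : Derivation ℤ R R,
        (∀ i ∈ (Finset.univ : Finset (Fin d)), δ (u i) ∈ Ideal.span {u i}) ∧ δ f = b}).map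
      (Subring.inclusion h.le) ≤
    Ideal.span {b | ∃ δ' : Derivation ℤ R₁ R₁,
      (∀ j ∈ (Finset.univ : Finset (Fin d)), δ' (u' j) ∈ Ideal.span {u' j}) ∧
        δ' (Subring.inclusion h.le f) = b} := by
  refine content_map_le_of_forall_exists_extension (Subring.inclusion h.le) f u Finset.univ u'
    Finset.univ ?_
  intro δ hδ
  obtain ⟨δ₁, hδ₁⟩ := exists_derivation_quadraticTransformAlong O R R₁ h δ
    (derivation_apply_mem_of_span_range_eq u hspan δ fun i => hδ i (Finset.mem_univ i))
  refine ⟨δ₁, ?_, hδ₁⟩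
  -- `u' i₀ = φ x`, so `δ₁ (u' i₀) = φ (δ x) = φ c * u' i₀`
  have h0 : u' i₀ = Subring.inclusion h.le (u i₀) := Subtype.ext hi₀
  obtain ⟨c, hc⟩ := Ideal.mem_span_singleton'.mp (hδ i₀ (Finset.mem_univ _))
  have hδ₁i₀ : δ₁ (u' i₀) = Subring.inclusion h.le c * u' i₀ := by
    rw [h0, hδ₁, ← hc, map_mul]
  intro i _
  by_cases hi : i = i₀
  · subst hi
    exact Ideal.mem_span_singleton'.mpr ⟨_, hδ₁i₀.symm⟩
  · -- `u' i * u' i₀ = φ (u i)`; apply `δ₁` and cancel `u' i₀ ≠ 0`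
    have hmul : u' i * u' i₀ = Subring.inclusion h.le (u i) := Subtype.ext (by
      rw [Subring.coe_mul, hj i hi, hi₀, Subring.coe_inclusion]
      exact div_mul_cancel₀ _ hx)
    obtain ⟨a, ha⟩ := Ideal.mem_span_singleton'.mp (hδ i (Finset.mem_univ _))
    have hne : u' i₀ ≠ 0 := by
      intro e
      apply hx
      rw [← hi₀, e, ZeroMemClass.coe_zero]
    have e1 : δ₁ (u' i * u' i₀) = u' i * δ₁ (u' i₀) + u' i₀ * δ₁ (u' i) := by
      rw [Derivation.leibniz, smul_eq_mul, smul_eq_mul]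
    have e2 : δ₁ (u' i * u' i₀) = Subring.inclusion h.le a * (u' i * u' i₀) := by
      rw [hmul, hδ₁, ← ha, map_mul]
    have key : u' i₀ * δ₁ (u' i) =
        u' i₀ * ((Subring.inclusion h.le a - Subring.inclusion h.le c) * u' i) := by
      linear_combination e2 - e1 - u' i * hδ₁i₀
    exact Ideal.mem_span_singleton'.mpr ⟨_, (mul_left_cancel₀ hne key).symm⟩

/-- **`C(φ f; R₁) ≤ C(f; R) · R₁` at the origin chart** (Giraud 1983 Rem. 1.6(4), inclusion `≤`
of `content_quadraticTransform_origin`). By `content_le_map_of_rich` (richness of `R` in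
`ℤ`-derivations and the dual derivations `D_i` of `u`) it suffices that the old parameters
`φ (u_i)` stay logarithmic for every `u'`-logarithmic derivation `δ'` of `R₁`:
`φ (u_{i₀}) = u'_{i₀}`, and for `j ≠ i₀`, `φ (u_j) = u'_j · u'_{i₀}` with
`δ' (u'_j u'_{i₀}) = u'_j δ' (u'_{i₀}) + u'_{i₀} δ' (u'_j) ∈ (u'_j u'_{i₀})`.
[folklore] -/
theorem content_quadraticTransform_origin_le_map (O : ValuationSubring K) (R R₁ : Subring K)
    (h : IsQuadraticTransformAlong O R R₁)
    (hrich : ∀ (N : Type) [CommRing N] (ψ : R →+* N) (δ₀ : R →+ N),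
      (∀ a b, δ₀ (a * b) = ψ a * δ₀ b + ψ b * δ₀ a) → ∀ Y : Finset R,
      ∃ (m : ℕ) (Δ : Fin m → Derivation ℤ R R) (nn : Fin m → N),
        ∀ y ∈ Y, δ₀ y = Finset.univ.sum fun j => ψ (Δ j y) * nn j)
    {d : ℕ} (u : Fin d → R) (D : Fin d → Derivation ℤ R R)
    (hD : ∀ i j, D i (u j) = if i = j then 1 else 0) (i₀ : Fin d) (hx : (u i₀ : K) ≠ 0)
    (u' : Fin d → R₁) (hi₀ : (u' i₀ : K) = (u i₀ : K))
    (hj : ∀ j, j ≠ i₀ → (u' j : K) = (u j : K) / (u i₀ : K)) (f : R) :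
    Ideal.span {b | ∃ δ' : Derivation ℤ R₁ R₁,
      (∀ j ∈ (Finset.univ : Finset (Fin d)), δ' (u' j) ∈ Ideal.span {u' j}) ∧
        δ' (Subring.inclusion h.le f) = b} ≤
    (Ideal.span {b | ∃ δ : Derivation ℤ R R,
        (∀ i ∈ (Finset.univ : Finset (Fin d)), δ (u i) ∈ Ideal.span {u i}) ∧ δ f = b}).map
      (Subring.inclusion h.le) := by
  refine content_le_map_of_rich (Subring.inclusion h.le) hrich u Finset.univ D hD u' Finset.univ
    f ?_
  intro i _ δ' hδ'
  by_cases hi : i = i₀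
  · subst hi
    have h0 : Subring.inclusion h.le (u i) = u' i := (Subtype.ext hi₀).symm
    rw [h0]
    exact hδ' i (Finset.mem_univ _)
  · have hmul : Subring.inclusion h.le (u i) = u' i * u' i₀ := Subtype.ext (by
      rw [Subring.coe_mul, hj i hi, hi₀, Subring.coe_inclusion]
      exact (div_mul_cancel₀ _ hx).symm)
    obtain ⟨c, hc⟩ := Ideal.mem_span_singleton'.mp (hδ' i₀ (Finset.mem_univ _))
    obtain ⟨e, he⟩ := Ideal.mem_span_singleton'.mp (hδ' i (Finset.mem_univ _))
    rw [hmul, Derivation.leibniz, smul_eq_mul, smul_eq_mul, ← hc, ← he]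
    exact Ideal.mem_span_singleton'.mpr ⟨c + e, by ring⟩

end Origin

/-- **Registered stub `content_quadraticTransform_origin`** (T5: Giraud 1983 Rem. 1.6(4) in tree
language). At the origin chart of the quadratic transform `R₁` of the local ring `R ⊆ K` along the
valuation ring `O`, with coordinates `u' i₀ = x := u i₀` and `u' j = u_j / x`, and with FULL
boundary on both sides, the log-content ideal of `f` transforms as the TOTAL transform:
`C(φ f; R₁, u') = C(f; R, u) · R₁`. The two inclusions are
`content_quadraticTransform_origin_le_map` and `content_map_le_quadraticTransform_origin`.
[folklore] -/
theorem content_quadraticTransform_origin : ∀ {K : Type} [Field K] (O : ValuationSubring K) (R R₁ : Subring K) [IsLocalRing R] (h : Literature.AlgebraicGeometry.Resolution.IsQuadraticTransformAlong O R R₁), (∀ (N : Type) [CommRing N] (ψ : R →+* N) (δ₀ : R →+ N), (∀ a b, δ₀ (a * b) = ψ a * δ₀ b + ψ b * δ₀ a) → ∀ Y : Finset R, ∃ (m : ℕ) (Δ : Fin m → Derivation ℤ R R) (nn : Fin m → N), ∀ y ∈ Y, δ₀ y = Finset.univ.sum fun j => ψ (Δ j y) * nn j) → ∀ {d : ℕ}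 (u : Fin d → R) (D : Fin d → Derivation ℤ R R), (∀ i j, D i (u j) = if i = j then 1 else 0) → Ideal.span (Set.range u) = maximalIdeal R → ∀ (i₀ : Fin d), (u i₀ : K) ≠ 0 → ∀ (u' : Fin d → R₁), (u' i₀ : K) = (u i₀ : K) → (∀ j, j ≠ i₀ → (u' j : K) = (u j : K) / (u i₀ : K)) → ∀ (f : R), Ideal.span {b | ∃ δ' : Derivation ℤ R₁ R₁, (∀ j ∈ (Finset.univ : Finset (Fin d)), δ' (u' j) ∈ Ideal.span {u' j}) ∧ δ' (Subring.inclusion h.le f) = b} = (Ideal.span {b | ∃ δ : Derivation ℤ R R, (∀ i ∈ (Finset.univ : Finset (Fin d)), δ (u i) ∈ Ideal.span {u i}) ∧ δ f = b}).map (Subring.inclusion h.le) := by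
  intro K _ O R R₁ _ h hrich d u D hD hspan i₀ hx u' hi₀ hj f
  exact le_antisymm
    (content_quadraticTransform_origin_le_map O R R₁ h hrich u D hD i₀ hx u' hi₀ hj f)
    (content_map_le_quadraticTransform_origin O R R₁ h u hspan i₀ hx u' hi₀ hj f)

end Summit.ResolutionOfSingularities.ResolutionOfSingularities.Theorems.PfaffLine
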